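import Summits.CriticalPhenomena.SAWScalingLimit.Theorems.SAWLoopFugacityFlowAvoidanceLimitAnchorDefs
import Summits.CriticalPhenomena.SAWScalingLimit.Theorems.SAWLoopFugacityFlowAvoidanceLimitSawEndpoint
import Summits.CriticalPhenomena.SAWScalingLimit.Theorems.SAWLoopFugacityFlowAvoidanceLimitLinearResponse
import Summits.CriticalPhenomena.SAWScalingLimit.Theorems.SAWLoopFugacityFlowAvoidanceLimitTwoLegLinearResponse
import Summits.CriticalPhenomena.SAWScalingLimit.Theorems.SAWLoopFugacityFlowAvoidanceLimitSourcesFactorisation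
import Literature.Probability.LatticeModels.DiluteLoopModelAnalyticity

/-!
# The linear-response LAW of the two-leg function at `n = 0`: `∂ₙ log twoLeg|₀ = E^γ[Π(Λ ∖ γ)] − Π(Λ)` —
helper of the lever `stub_cornerLipschitz` of line `saw-corner-germ`
(crux `SAWLoopFugacityFlow.AvoidanceLimit`, stmt-CriticalPhenomena-10649)

Assembly of the lead's assessment §1 (the card's `LinearResponseLaw` at finite volume) from the landed
walk/loop factorisation `Corner.partitionFunction_sources_eq_sum_paths` (p101099), the landed linear responses
`Corner.hasDerivAt_partitionFunction_zero` (p99219) and `Corner.hasDerivAt_twoLegDim_zero` (p101182):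

* `oneLoop_sources_eq_sum_paths`: differentiating the factorisation at `n = 0` (both sides are polynomials in `n`;
  uniqueness of derivatives) gives the ONE-LOOP factorisation
  `Σ_{F : sources {a,b}, one loop} x^{|F|} = Σ_γ x^{|γ|} · Π(Λ ∖ γ)`, `Π(Λ') := Σ_{F ⊆ Λ', one loop, no source} x^{|F|}`
  (the polygon generating function off the walk);
* `hasDerivAt_log_twoLegDim_zero`: hence, wherever the path generating function is positive,
  `∂ₙ log (Z_n({a,b})/Z_n(∅))|₀ = (Σ_γ x^{|γ|} Π(Λ ∖ γ)) / (Σ_γ x^{|γ|}) − Π(Λ) = −E^γ[M(γ)]`,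
  `M(γ) = Π(Λ) − Π(Λ ∖ γ)` the `x`-mass of polygons MEETING `γ` (de Gennes: switching on the loops costs each walk
  the polygons it forbids);
* `hasDerivAt_log_ratio_zero`: the route ratio `R_δ(n, 0, x)` (confined over unconfined) has
  `∂ₙ log R_δ|₀ = [law on the confined graph] − [law on Ω_δ]` — the DIFFERENCED contact functional of the lever
  (at fixed edge fugacity; the motion of the critical curve adds the `ℓ|γ|` term of `…FugacityResponse.lean`).

Sources: N. Madras, G. Slade, *The Self-Avoiding Walk* (1993), §1.2–§1.3 [MadrasSlade1993]; J. L. Jacobsen, LNP 775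
(2009), ch. 14, §14.3.1 (n → 0) [Jacobsen2009]. No new definitions; nothing about the scaling limit is asserted here.
-/

noncomputable section

open Finset
open scoped symmDiff
open Literature.Probability.RandomPlanarGeometry Literature.Probability.LatticeModels
open Summit.CriticalPhenomena.SAWScalingLimit.Theorems.AvoidanceLimit.Anchor

namespace Summit.CriticalPhenomena.SAWScalingLimit.Theorems.AvoidanceLimit.Corner

/-- **One-loop factorisation** (`w = 0`, subgraph of `ℤ²`, `a ≠ b`): the generating function of the collision-free
two-source configurations with exactly one loop factorises over the open strand,
`Σ_{F : sources {a,b}, one loop} x^{|F|} = Σ_γ x^{|γ|} · Σ_{F' ⊆ Λ ∖ V(γ) : one loop, no source} x^{|F'|}` — the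
`n`-derivative at `0` of the walk/loop factorisation `Corner.partitionFunction_sources_eq_sum_paths`.
[cite: MadrasSlade1993, §1.2] -/
theorem oneLoop_sources_eq_sum_paths :
    ∀ (H : SimpleGraph (Site 2)) [H.LocallyFinite], H ≤ zdGraph 2 →
      ∀ (x : ℝ) (Λ : Finset (Site 2)) (a b : Site 2), a ≠ b →
        ∑ F ∈ (DiluteLoopModel.configs H Λ ({a} ∆ {b})).filter
            (fun F => DiluteLoopModel.oscVerts Λ F = ∅ ∧ DiluteLoopModel.loops Λ F ∅ = 1), x ^ #F =
          ∑ p ∈ DiluteLoopModel.pathsIn H Λ a b, x ^ p.length *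
            ∑ F ∈ (DiluteLoopModel.configs H (Λ \ p.support.toFinset) ∅).filter
              (fun F => DiluteLoopModel.oscVerts (Λ \ p.support.toFinset) F = ∅ ∧
                DiluteLoopModel.loops (Λ \ p.support.toFinset) F ∅ = 1), x ^ #F := by
  intro H _ hH x Λ a b hab
  have h1 := hasDerivAt_partitionFunction_zero H x Λ ({a} ∆ {b})
  have h2 : HasDerivAt (fun n : ℝ => ∑ p ∈ DiluteLoopModel.pathsIn H Λ a b,
      x ^ p.length * (⟨n, 0, x⟩ : DiluteLoopModel ℝ).partitionFunction H (Λ \ p.support.toFinset) ∅)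
      (∑ p ∈ DiluteLoopModel.pathsIn H Λ a b, x ^ p.length *
        ∑ F ∈ (DiluteLoopModel.configs H (Λ \ p.support.toFinset) ∅).filter
          (fun F => DiluteLoopModel.oscVerts (Λ \ p.support.toFinset) F = ∅ ∧
            DiluteLoopModel.loops (Λ \ p.support.toFinset) F ∅ = 1), x ^ #F) 0 :=
    HasDerivAt.fun_sum fun p _ =>
      (hasDerivAt_partitionFunction_zero H x (Λ \ p.support.toFinset) ∅).const_mul (x ^ p.length)
  have hfun : (fun n : ℝ => (⟨n, 0, x⟩ : DiluteLoopModel ℝ).partitionFunction H Λ ({a} ∆ {b})) =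
      fun n : ℝ => ∑ p ∈ DiluteLoopModel.pathsIn H Λ a b,
        x ^ p.length * (⟨n, 0, x⟩ : DiluteLoopModel ℝ).partitionFunction H (Λ \ p.support.toFinset) ∅ :=
    funext fun n => partitionFunction_sources_eq_sum_paths H hH n x Λ a b hab
  rw [hfun] at h1
  exact h1.unique h2

/-- **The linear-response law at finite volume** (`w = 0`, subgraph of `ℤ²`, `a ≠ b`, positive path generating
function): `∂ₙ log twoLegDim(n, 0, x)|_{n=0} = (Σ_γ x^{|γ|} Π(Λ ∖ γ)) / (Σ_γ x^{|γ|}) − Π(Λ)`, i.e. minus the mean, under the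
SAW law `∝ x^{|γ|}`, of the `x`-mass of polygons meeting the walk.
[cite: Jacobsen2009, §14.3.1 (n → 0: the first order in n is one loop)] -/
theorem hasDerivAt_log_twoLegDim_zero :
    ∀ (H : SimpleGraph (Site 2)) [H.LocallyFinite], H ≤ zdGraph 2 →
      ∀ (x : ℝ) (Λ : Finset (Site 2)) (a b : Site 2), a ≠ b →
        0 < ∑ p ∈ DiluteLoopModel.pathsIn H Λ a b, x ^ p.length →
    HasDerivAt (fun n : ℝ => Real.log (twoLegDim n 0 x H Λ a b))
      ((∑ p ∈ DiluteLoopModel.pathsIn H Λ a b, x ^ p.length *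
          ∑ F ∈ (DiluteLoopModel.configs H (Λ \ p.support.toFinset) ∅).filter
            (fun F => DiluteLoopModel.oscVerts (Λ \ p.support.toFinset) F = ∅ ∧
              DiluteLoopModel.loops (Λ \ p.support.toFinset) F ∅ = 1), x ^ #F) /
          (∑ p ∈ DiluteLoopModel.pathsIn H Λ a b, x ^ p.length) -
        ∑ F ∈ (DiluteLoopModel.configs H Λ ∅).filter
          (fun F => DiluteLoopModel.oscVerts Λ F = ∅ ∧ DiluteLoopModel.loops Λ F ∅ = 1), x ^ #F) 0 := by
  intro H _ hH x Λ a b hab hpos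
  -- the two partition functions as functions of `n`, their values and derivatives at `0`
  set Zab : ℝ → ℝ := fun n => (⟨n, 0, x⟩ : DiluteLoopModel ℝ).partitionFunction H Λ ({a} ∆ {b}) with hZab
  set Z0 : ℝ → ℝ := fun n => (⟨n, 0, x⟩ : DiluteLoopModel ℝ).partitionFunction H Λ ∅ with hZ0
  set P : ℝ := ∑ p ∈ DiluteLoopModel.pathsIn H Λ a b, x ^ p.length with hP
  set Lab : ℝ := ∑ F ∈ (DiluteLoopModel.configs H Λ ({a} ∆ {b})).filter
    (fun F => DiluteLoopModel.oscVerts Λ F = ∅ ∧ DiluteLoopModel.loops Λ F ∅ = 1), x ^ #F with hLab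
  set L0 : ℝ := ∑ F ∈ (DiluteLoopModel.configs H Λ ∅).filter
    (fun F => DiluteLoopModel.oscVerts Λ F = ∅ ∧ DiluteLoopModel.loops Λ F ∅ = 1), x ^ #F with hL0
  have hZab0 : Zab 0 = P := by
    simp only [hZab, hP]
    exact DiluteLoopModel.partitionFunction_zero_zero_eq_sum_paths hH x Λ hab
  have hZ00 : Z0 0 = 1 := by
    simp only [hZ0]
    exact DiluteLoopModel.partitionFunction_zero_zero_empty hH x Λ
  have hdab : HasDerivAt Zab Lab 0 := hasDerivAt_partitionFunction_zero H x Λ ({a} ∆ {b})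
  have hd0 : HasDerivAt Z0 L0 0 := hasDerivAt_partitionFunction_zero H x Λ ∅
  -- the normalised two-leg function is the quotient
  have hfun : (fun n : ℝ => Real.log (twoLegDim n 0 x H Λ a b)) = fun n => Real.log (Zab n / Z0 n) := by
    funext n
    simp only [twoLegDim, hZab, hZ0, dimerPF_dimerFugacity_zero]
  rw [hfun]
  have hquot : HasDerivAt (fun n => Zab n / Z0 n) ((Lab * Z0 0 - Zab 0 * L0) / Z0 0 ^ 2) 0 :=
    hdab.fun_div hd0 (by rw [hZ00]; exact one_ne_zero)
  have hne : Zab 0 / Z0 0 ≠ 0 := by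
    rw [hZab0, hZ00, div_one]
    exact hpos.ne'
  have hlog := hquot.log hne
  -- the one-loop factorisation rewrites `Lab`
  have hLab' : Lab = ∑ p ∈ DiluteLoopModel.pathsIn H Λ a b, x ^ p.length *
      ∑ F ∈ (DiluteLoopModel.configs H (Λ \ p.support.toFinset) ∅).filter
        (fun F => DiluteLoopModel.oscVerts (Λ \ p.support.toFinset) F = ∅ ∧
          DiluteLoopModel.loops (Λ \ p.support.toFinset) F ∅ = 1), x ^ #F := by
    rw [hLab]
    exact oneLoop_sources_eq_sum_paths H hH x Λ a b hab
  refine hlog.congr_deriv ?_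
  rw [hZab0, hZ00, ← hLab']
  have hP0 : P ≠ 0 := hpos.ne'
  field_simp

/-- **Linear response of the route ratio `R_δ` at `n = 0`** (dimer fugacity `0`, fixed edge fugacity `x`): if the
path generating functions of the confined graph and of `Ω_δ` between `a ≠ b` are positive, then
`∂ₙ log R_δ(n, 0, x)|₀ = [∂ₙ log twoLeg(confined)|₀] − [∂ₙ log twoLeg(Ω_δ)|₀]`, each bracket being the quotient-rule
value `(L_{ab} − P L_∅)/P` of the corresponding graph — under the factorisation hypothesis these are the differenced
contact-functional expectations of the lever (`hasDerivAt_log_twoLegDim_zero`). [cite: MadrasSlade1993, §1.2] -/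
theorem hasDerivAt_log_ratio_zero :
    ∀ (Ω S : Set ℂ) (δ x : ℝ) (a b : Site 2), a ≠ b →
    0 < ∑ p ∈ DiluteLoopModel.pathsIn (confinedGraph Ω S δ) (meshDomainFinset Ω δ) a b, x ^ p.length →
    0 < ∑ p ∈ DiluteLoopModel.pathsIn (discreteDomainGraph Ω δ) (meshDomainFinset Ω δ) a b, x ^ p.length →
    HasDerivAt (fun n : ℝ => Real.log (Rδ n 0 x Ω S δ a b))
      (((∑ F ∈ (DiluteLoopModel.configs (confinedGraph Ω S δ) (meshDomainFinset Ω δ) ({a} ∆ {b})).filter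
            (fun F => DiluteLoopModel.oscVerts (meshDomainFinset Ω δ) F = ∅ ∧
              DiluteLoopModel.loops (meshDomainFinset Ω δ) F ∅ = 1), x ^ #F) -
          (∑ p ∈ DiluteLoopModel.pathsIn (confinedGraph Ω S δ) (meshDomainFinset Ω δ) a b, x ^ p.length) *
            (∑ F ∈ (DiluteLoopModel.configs (confinedGraph Ω S δ) (meshDomainFinset Ω δ) ∅).filter
              (fun F => DiluteLoopModel.oscVerts (meshDomainFinset Ω δ) F = ∅ ∧
                DiluteLoopModel.loops (meshDomainFinset Ω δ) F ∅ = 1), x ^ #F)) /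
          (∑ p ∈ DiluteLoopModel.pathsIn (confinedGraph Ω S δ) (meshDomainFinset Ω δ) a b, x ^ p.length) -
        ((∑ F ∈ (DiluteLoopModel.configs (discreteDomainGraph Ω δ) (meshDomainFinset Ω δ) ({a} ∆ {b})).filter
            (fun F => DiluteLoopModel.oscVerts (meshDomainFinset Ω δ) F = ∅ ∧
              DiluteLoopModel.loops (meshDomainFinset Ω δ) F ∅ = 1), x ^ #F) -
          (∑ p ∈ DiluteLoopModel.pathsIn (discreteDomainGraph Ω δ) (meshDomainFinset Ω δ) a b, x ^ p.length) *
            (∑ F ∈ (DiluteLoopModel.configs (discreteDomainGraph Ω δ) (meshDomainFinset Ω δ) ∅).filter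
              (fun F => DiluteLoopModel.oscVerts (meshDomainFinset Ω δ) F = ∅ ∧
                DiluteLoopModel.loops (meshDomainFinset Ω δ) F ∅ = 1), x ^ #F)) /
          (∑ p ∈ DiluteLoopModel.pathsIn (discreteDomainGraph Ω δ) (meshDomainFinset Ω δ) a b, x ^ p.length)) 0 := by
  intro Ω S δ x a b hab hpos' hpos
  have hG' : confinedGraph Ω S δ ≤ zdGraph 2 := confinedGraph_le_zdGraph Ω S δ
  have hG : discreteDomainGraph Ω δ ≤ zdGraph 2 :=
    (discreteDomainGraph_le_meshGraph Ω δ).trans (meshGraph_le_zdGraph Ω δ)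
  have h1 := hasDerivAt_twoLegDim_zero _ hG' x (meshDomainFinset Ω δ) a b hab
  have h2 := hasDerivAt_twoLegDim_zero _ hG x (meshDomainFinset Ω δ) a b hab
  have hv1 : twoLegDim (0 : ℝ) 0 x (confinedGraph Ω S δ) (meshDomainFinset Ω δ) a b =
      ∑ p ∈ DiluteLoopModel.pathsIn (confinedGraph Ω S δ) (meshDomainFinset Ω δ) a b, x ^ p.length :=
    twoLegDim_zero_zero_eq_sum_paths hG' x _ hab
  have hv2 : twoLegDim (0 : ℝ) 0 x (discreteDomainGraph Ω δ) (meshDomainFinset Ω δ) a b =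
      ∑ p ∈ DiluteLoopModel.pathsIn (discreteDomainGraph Ω δ) (meshDomainFinset Ω δ) a b, x ^ p.length :=
    twoLegDim_zero_zero_eq_sum_paths hG x _ hab
  have hne1 : twoLegDim (0 : ℝ) 0 x (confinedGraph Ω S δ) (meshDomainFinset Ω δ) a b ≠ 0 := by
    rw [hv1]; exact hpos'.ne'
  have hne2 : twoLegDim (0 : ℝ) 0 x (discreteDomainGraph Ω δ) (meshDomainFinset Ω δ) a b ≠ 0 := by
    rw [hv2]; exact hpos.ne'
  have hfun : (fun n : ℝ => Real.log (Rδ n 0 x Ω S δ a b)) = fun n =>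
      Real.log (twoLegDim n 0 x (confinedGraph Ω S δ) (meshDomainFinset Ω δ) a b /
        twoLegDim n 0 x (discreteDomainGraph Ω δ) (meshDomainFinset Ω δ) a b) := by
    funext n
    rfl
  rw [hfun]
  have hquot := (h1.fun_div h2 hne2).log (div_ne_zero hne1 hne2)
  refine hquot.congr_deriv ?_
  rw [hv1, hv2]
  have hP1 := hpos'.ne'
  have hP2 := hpos.ne'
  field_simp

end Summit.CriticalPhenomena.SAWScalingLimit.Theorems.AvoidanceLimit.Corner

end
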